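import Literature.AlgebraicGeometry.Frobenioids.ArithmeticFrobenioidThm64iVariants
import Literature.AlgebraicGeometry.Frobenioids.ArithmeticFrobenioidIsotropic
import Literature.AlgebraicGeometry.Frobenioids.ArithmeticDivisorsPerfFactorial
import Literature.AlgebraicGeometry.Frobenioids.ArithmeticDivisorsPrimes
import Literature.AlgebraicGeometry.Frobenioids.BiratLocalization
import Literature.AlgebraicGeometry.Frobenioids.CoAngularPreSteps
import Literature.AlgebraicGeometry.Frobenioids.RigiditySlimness
import Literature.AlgebraicGeometry.Frobenioids.RigiditySlimnessHypothesisB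
import Literature.AlgebraicGeometry.Frobenioids.NaiveFrobeniusFunctorLifts
import Literature.AlgebraicGeometry.Frobenioids.UnitWiseFrobeniusZetaExists
import Literature.AlgebraicGeometry.Frobenioids.ModelFrobenioidBaseSectionSkeleton
import Literature.AlgebraicGeometry.Frobenioids.ModelFrobenioidUnits
import Literature.AlgebraicGeometry.Frobenioids.ModelFrobenioidComparisonFull2
import Literature.AlgebraicGeometry.Frobenioids.PerfFactorialPrimes
import Literature.AlgebraicGeometry.Frobenioids.PerfectionModelType
import Literature.AlgebraicGeometry.Frobenioids.Thm34ConsequencesAsPrinted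
import Literature.AlgebraicGeometry.Frobenioids.Thm42AsTypedAllFrobenioids
import Literature.AlgebraicGeometry.Frobenioids.Thm49IsotropicWLOG
import Literature.AlgebraicGeometry.Frobenioids.BaseCategoryTheoreticityHypBNecessity
import Literature.AlgebraicGeometry.Frobenioids.PadicFrobenioidCZeroSlim
import HarnessLib

/-!
# Frobenioids I §§1–5 / Frobenioids II Thm. 1.2 (iv): printed SUBJECT-HYPOTHESES discharged at genuine carriers

Mochizuki, *The geometry of Frobenioids I: the general theory*, Kyushu J. Math. **62** (2008) 293–400
[cite: MochizukiFrdI2008, Thm. 6.4 (i) p.114]; *The geometry of Frobenioids II: poly-Frobenioids*, Kyushu J.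
Math. **62** (2008) 401–460 [cite: MochizukiFrdII2008, Ex 1.1 (i) p.7].

PROOF-ONLY file (abc-iut cell, seat abc-iut-L1-t4 gen 8, cone K4 / C-R33 re-close of the sixteen L1 nodes classed
PH-INHABITED in abc-iut-c312-2's CONE-K4-RECLOSE.tsv v4; 0 definitions). For sixteen numbered items of [FrdI]
§§1–5 and [FrdII] Thm. 1.2 (iv) the tree's closing theorems are ∀-generic in their data and carry a printed
SUBJECT-HYPOTHESIS as a binder (`IsOfFSMType D`, `HasBiratSquares F`, `HasCoAngularSquares F ε`,
`HasFrobeniusLifts F d`, `IsSharp`/`IsIntegral (Φ(A))`, `SlimHypothesisB F X`, `IsBaseFrobeniusPair F P Fr`,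
`IsPrimary x`, `IsOfGroupLikeType`, `IsBiratFrobeniusNormalized`). Each theorem below RE-STATES such a closing
theorem with that binder SUPPLIED by its accepted producer — either for every Frobenioid (where the producer is
itself general: Prop. 1.11 (vii) `hasCoAngularSquares`, Prop. 1.10 (i) `hasFrobeniusLifts`, Prop. 4.4
`hasBiratSquares_of_isFrobenioid`), or at the genuine carriers of the tree: the arithmetic Frobenioid `C_{K/F}` of
[FrdI] Ex. 6.3 / Thm. 6.4 over `D = FinSubextCat F K` (`K/F` Galois, print p. 109 «Galois»), THE `p`-adic
Frobenioid `C₀(p)` of [FrdII] Ex. 1.1 (i) over `D₀`, the monoid `Φ(Spec L)` of effective arithmetic divisors, and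
print's own group-like Example 3.6. Binder-free closers that already EXIST are cited BY NAME, never restated
([FrdII] Thm. 1.2 (iv): `PadicFrd.Datum.thm12_iv_holds`, `PadicFrd.czeroGal_isSlim`; [FrdI] Thm. 4.2:
`FrdI.T42.thm42i_ofFunctor` &c.; Thm. 5.1 (iv): `PreFrobenioid.thm51iv_modelType_arith`; Thm. 5.2 (iv):
`PreFrobenioid.thm52iv_holds'`; Cor. 4.10: `PreFrobenioid.cor410_biratData_asPrinted`) — only their at-carrier
specialisations are added where the tree had none. No statement of either paper is strengthened; the original
closers are untouched. Nothing here bears on [IUTchIII] Cor. 3.12 or asserts anything about abc.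
-/

set_option backward.isDefEq.respectTransparency false

namespace Literature.AlgebraicGeometry.Frobenioids

open CategoryTheory Opposite

universe w v v' u u'

/-! ## A. Generic forms: the subject-hypothesis is a THEOREM for every Frobenioid -/

namespace PreFrobenioid

section Generic

variable {D : Type u} [Category.{v} D] {Φ : Dᵒᵖ ⥤ CommMonCat.{w}} {C : Type u'} [Category.{v'} C]
  {F : C ⥤ ElemFrobenioid Φ}

/-- **[FrdI] Prop. 1.11 (vii), composition clause, for every Frobenioid**: the co-angular square property of a
composite `ε₁ ≫ ε₂` — `HasCoAngularSquares.comp` with both hypotheses supplied by Prop. 1.11 (vii) itself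
(`hasCoAngularSquares`). [cite: MochizukiFrdI2008, Prop. 1.11(vii) p.38] -/
theorem hasCoAngularSquares_comp_of_isFrobenioid (hF : IsFrobenioid F) {X Y B : C} (ε₁ : X ⟶ Y) (ε₂ : Y ⟶ B) :
    HasCoAngularSquares F (ε₁ ≫ ε₂) :=
  HasCoAngularSquares.comp (hasCoAngularSquares hF ε₁) (hasCoAngularSquares hF ε₂)

/-- **[FrdI] Prop. 1.13 (ii) for a pre-Frobenioid with DIVISORIAL `Φ`** (print p. 40: «Since `Φ` is divisorial,
hence, in particular, sharp»): an automorphism of an object of `F_Φ` with trivial base component is trivial —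
`ElemFrobenioid_iso_hom_eq_id_of_base` with sharpness supplied by divisoriality. [cite: MochizukiFrdI2008, Prop. 1.13(ii) p.40] -/
theorem ElemFrobenioid_iso_hom_eq_id_of_base_of_isDivisorial
    (hΦ : Objectwise (fun M _ => IsDivisorial M) Φ) {A : ElemFrobenioid Φ} (i : A ≅ A)
    (hb : ElemFrobenioid.Base i.hom = 𝟙 _) : i.hom = 𝟙 A :=
  ElemFrobenioid_iso_hom_eq_id_of_base (hΦ A.base).isSharp i hb

/-- **[FrdI] Prop. 2.1 (i) for every Frobenioid, defining square**: `φ' ∘ α_A = α_B ∘ φ` for the naive Frobenius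
functor of a Frobenius choice `ch`, the lifting hypothesis of Prop. 1.10 (i) supplied by `hasFrobeniusLifts`.
[cite: MochizukiFrdI2008, Prop. 2.1(i) p.44] -/
theorem FrobeniusChoice.hom_lift_of_isFrobenioid (hF : IsFrobenioid F) {d : ℕ+} (ch : FrobeniusChoice F d)
    {A B : C} (φ : A ⟶ B) : ch.hom A ≫ ch.lift (hasFrobeniusLifts hF d) φ = φ ≫ ch.hom B :=
  ch.hom_lift (hasFrobeniusLifts hF d) φ

/-- **[FrdI] Prop. 2.1 (i) for every Frobenioid, uniqueness of `φ'`**. [cite: MochizukiFrdI2008, Prop. 2.1(i) p.44] -/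
theorem FrobeniusChoice.lift_unique_of_isFrobenioid (hF : IsFrobenioid F) {d : ℕ+} (ch : FrobeniusChoice F d)
    {A B : C} (φ : A ⟶ B) (φ' : ch.obj A ⟶ ch.obj B) (hφ' : ch.hom A ≫ φ' = φ ≫ ch.hom B) :
    φ' = ch.lift (hasFrobeniusLifts hF d) φ :=
  ch.lift_unique (hasFrobeniusLifts hF d) φ φ' hφ'

/-- **[FrdI] Prop. 2.1 (i) for every Frobenioid, `deg_Fr(φ') = deg_Fr(φ)`**. [cite: MochizukiFrdI2008, Prop. 2.1(i) p.44] -/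
theorem FrobeniusChoice.degFr_lift_of_isFrobenioid (hF : IsFrobenioid F) {d : ℕ+} (ch : FrobeniusChoice F d)
    {A B : C} (φ : A ⟶ B) : degFr F (ch.lift (hasFrobeniusLifts hF d) φ) = degFr F φ :=
  ch.degFr_lift (hasFrobeniusLifts hF d) φ

/-- **[FrdI] Prop. 2.1 (i) for every Frobenioid, `α_A^*(Div(φ')) = d · Div(φ)`**. [cite: MochizukiFrdI2008, Prop. 2.1(i) p.44] -/
theorem FrobeniusChoice.pull_div_lift_of_isFrobenioid (hF : IsFrobenioid F) {d : ℕ+} (ch : FrobeniusChoice F d)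
    {A B : C} (φ : A ⟶ B) :
    pull Φ (Base F (ch.hom A)) (Div F (ch.lift (hasFrobeniusLifts hF d) φ)) = Div F φ ^ (d : ℕ) :=
  ch.pull_div_lift (hasFrobeniusLifts hF d) φ

/-- **[FrdI] Prop. 2.1 (i) for every Frobenioid, `Ψ(A) = A'`, `Ψ(φ) = φ'`** for the naive Frobenius functor built
with the lifting property of Prop. 1.10 (i). [cite: MochizukiFrdI2008, Prop. 2.1(i) p.44] -/
theorem naiveFrobenius_obj_map_of_isFrobenioid (hF : IsFrobenioid F) {d : ℕ+} (ch : FrobeniusChoice F d)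
    {A B : C} (φ : A ⟶ B) :
    (naiveFrobenius ch (hasFrobeniusLifts hF d)).obj A = ch.obj A ∧
      (naiveFrobenius ch (hasFrobeniusLifts hF d)).map φ = ch.lift (hasFrobeniusLifts hF d) φ :=
  ⟨naiveFrobenius_obj ch _ A, naiveFrobenius_map ch _ φ⟩

end Generic

section Cor410

variable {D₁ : Type u} [Category.{v} D₁] {Φ₁ : D₁ᵒᵖ ⥤ CommMonCat.{w}} {C₁ : Type u'} [Category.{v'} C₁]
  {D₂ : Type u} [Category.{v} D₂] {Φ₂ : D₂ᵒᵖ ⥤ CommMonCat.{w}} {C₂ : Type u'} [Category.{v'} C₂]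
  {F₁ : C₁ ⥤ ElemFrobenioid Φ₁} {F₂ : C₂ ⥤ ElemFrobenioid Φ₂}

/-- **[FrdI] Cor. 4.10 AS TYPED at THE birationalizations, for every pair of Frobenioids and every equivalence,
with NO square-completion binder**: `cor410_biratData_asPrinted` (printed antecedents consumed from the typed
statement) with `HasBiratSquares F_i` supplied by Prop. 4.4's calculus of fractions
(`hasBiratSquares_of_isFrobenioid`). [cite: MochizukiFrdI2008, Cor. 4.10 p.90] -/
theorem cor410_biratData_asPrinted_of_isFrobenioid (hF₁ : IsFrobenioid F₁) (hF₂ : IsFrobenioid F₂) (Ψ : C₁ ≌ C₂) :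
    PreFrobenioidData.Cor410 (PreFrobenioidData.ofFunctor Φ₁ F₁) (PreFrobenioidData.ofFunctor Φ₂ F₂) Ψ
      (biratData hF₁ (hasBiratSquares_of_isFrobenioid hF₁)) (biratData hF₂ (hasBiratSquares_of_isFrobenioid hF₂)) :=
  cor410_biratData_asPrinted hF₁ _ hF₂ _ Ψ

end Cor410

end PreFrobenioid

/-! ## B. At the arithmetic Frobenioid `C_{K/F}` of [FrdI] Ex. 6.3 / Thm. 6.4 -/

section Arith

variable (F : Type) [Field F] [NumberField F] (K : Type) [Field K] [Algebra F K] [IsGalois F K]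

/-- **[FrdI] Prop. 1.11 (vii) at `C_{K/F}`**: every composite arrow has the co-angular square property.
[cite: MochizukiFrdI2008, Prop. 1.11(vii) p.38] -/
theorem hasCoAngularSquares_comp_arith {X Y B : arithFrobenioid F K} (ε₁ : X ⟶ Y) (ε₂ : Y ⟶ B) :
    PreFrobenioid.HasCoAngularSquares
      (ModelFrobenioid.toElem (arithDivisorFunctor F K) (unitsFunctor F K) (divNatTrans F K)) (ε₁ ≫ ε₂) :=
  PreFrobenioid.hasCoAngularSquares_comp_of_isFrobenioid (arithFrobenioid_isFrobenioid F K) ε₁ ε₂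

omit [IsGalois F K] in
/-- **[FrdI] Prop. 1.13 (ii) at `Φ = ` the divisor monoid of Ex. 6.3** (`Φ(Spec L)` = effective arithmetic
divisors, divisorial): an automorphism of an object of `F_Φ` over the identity of `D` is the identity.
[cite: MochizukiFrdI2008, Prop. 1.13(ii) p.40] -/
theorem ElemFrobenioid_iso_hom_eq_id_of_base_arith {A : ElemFrobenioid (arithDivisorFunctor F K)} (i : A ≅ A)
    (hb : ElemFrobenioid.Base i.hom = 𝟙 _) : i.hom = 𝟙 A :=
  PreFrobenioid.ElemFrobenioid_iso_hom_eq_id_of_base (arithDivisorFunctor_isDivisorial F K A.base).isSharp i hb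

/-- **[FrdI] Prop. 2.1 (i) at `C_{K/F}`**: the defining square and `deg_Fr(φ') = deg_Fr(φ)` of the naive Frobenius
functor of any Frobenius choice of degree `d`. [cite: MochizukiFrdI2008, Prop. 2.1(i) p.44] -/
theorem frobeniusChoice_lift_arith {d : ℕ+}
    (ch : PreFrobenioid.FrobeniusChoice
      (ModelFrobenioid.toElem (arithDivisorFunctor F K) (unitsFunctor F K) (divNatTrans F K)) d)
    {A B : arithFrobenioid F K} (φ : A ⟶ B) :
    ch.hom A ≫ ch.lift (PreFrobenioid.hasFrobeniusLifts (arithFrobenioid_isFrobenioid F K) d) φ = φ ≫ ch.hom B ∧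
      PreFrobenioid.degFr (ModelFrobenioid.toElem (arithDivisorFunctor F K) (unitsFunctor F K) (divNatTrans F K))
          (ch.lift (PreFrobenioid.hasFrobeniusLifts (arithFrobenioid_isFrobenioid F K) d) φ) =
        PreFrobenioid.degFr (ModelFrobenioid.toElem (arithDivisorFunctor F K) (unitsFunctor F K) (divNatTrans F K)) φ :=
  ⟨ch.hom_lift _ φ, ch.degFr_lift _ φ⟩

/-- **[FrdI] Prop. 2.9 (ii) at `C_{K/F}` with THE base-Frobenius pair of the Thm. 5.2 proof (p. 101)** — the zero
section over the chosen skeleton of `D` and its Frobenius endomorphisms (`ModelFrobenioid.isBaseFrobeniusPair_skel`):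
the invariants of a factored arrow `F(n)_A ; β ; α` — `Div = Div(β)`, `deg_Fr = n`, `Base = Base(α)`.
[cite: MochizukiFrdI2008, Prop. 2.9(ii) p.55] -/
theorem unitWiseFrobeniusZeta_factor_arith {A B : arithFrobenioid F K}
    (hA : (ModelFrobenioid.skelPresection (arithDivisorFunctor F K) (unitsFunctor F K) (divNatTrans F K)).obj A)
    (n : ℕ+)
    (β : PreFrobenioid.endSubmonoid
      (ModelFrobenioid.toElem (arithDivisorFunctor F K) (unitsFunctor F K) (divNatTrans F K)) A)
    {α : A ⟶ B}
    (hα : (ModelFrobenioid.skelPresection (arithDivisorFunctor F K) (unitsFunctor F K) (divNatTrans F K)).hom α) :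
    PreFrobenioid.Div (ModelFrobenioid.toElem (arithDivisorFunctor F K) (unitsFunctor F K) (divNatTrans F K))
        (PreFrobenioid.BaseFrobeniusPair.frob
          (ModelFrobenioid.skelFrobeniusSection (arithDivisorFunctor F K) (unitsFunctor F K) (divNatTrans F K))
          n hA ≫ (β.1 : A ⟶ A) ≫ α) =
      PreFrobenioid.divHom (ModelFrobenioid.toElem (arithDivisorFunctor F K) (unitsFunctor F K) (divNatTrans F K)) A β ∧
    PreFrobenioid.degFr (ModelFrobenioid.toElem (arithDivisorFunctor F K) (unitsFunctor F K) (divNatTrans F K))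
        (PreFrobenioid.BaseFrobeniusPair.frob
          (ModelFrobenioid.skelFrobeniusSection (arithDivisorFunctor F K) (unitsFunctor F K) (divNatTrans F K))
          n hA ≫ (β.1 : A ⟶ A) ≫ α) = n ∧
    PreFrobenioid.Base (ModelFrobenioid.toElem (arithDivisorFunctor F K) (unitsFunctor F K) (divNatTrans F K))
        (PreFrobenioid.BaseFrobeniusPair.frob
          (ModelFrobenioid.skelFrobeniusSection (arithDivisorFunctor F K) (unitsFunctor F K) (divNatTrans F K))
          n hA ≫ (β.1 : A ⟶ A) ≫ α) =
      PreFrobenioid.Base (ModelFrobenioid.toElem (arithDivisorFunctor F K) (unitsFunctor F K) (divNatTrans F K)) α :=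
  have hpair := ModelFrobenioid.isBaseFrobeniusPair_skel (DivB := divNatTrans F K)
    (arithDivisorFunctor_isDivisorial F K) (unitsFunctor_isGroupLike F K)
  ⟨PreFrobenioid.UnitWiseFrobeniusZeta.div_factor (arithFrobenioid_isFrobenioid F K) hpair hA n β hα,
    PreFrobenioid.UnitWiseFrobeniusZeta.degFr_factor hpair (arithFrobenioid_isFrobenioid F K) hA n β hα,
    PreFrobenioid.UnitWiseFrobeniusZeta.base_factor hpair hA n β α⟩

/-- **[FrdI] Prop. 5.5 (iii) at `C_{K/F}`**: the base-Frobenius pair of the perfection `C_{K/F}^pf` EXHIBITED as the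
image of THE base-Frobenius pair of the Thm. 5.2 proof. [cite: MochizukiFrdI2008, Prop. 5.5 (iii) p.104] -/
theorem perfection_exists_isBaseFrobeniusPair_image_arith :
    ∃ (P' : Presection (PreFrobenioid.Perfection (arithFrobenioid_isFrobenioid F K)))
      (Fr' : ℕ+ →* End P'.ι)
      (hobj : ∀ A : arithFrobenioid F K,
        (ModelFrobenioid.skelPresection (arithDivisorFunctor F K) (unitsFunctor F K) (divNatTrans F K)).obj A →
          P'.obj ((PreFrobenioid.Perfection.toPf (arithFrobenioid_isFrobenioid F K)).obj A)),
      (∀ ⦃A B : arithFrobenioid F K⦄ (f : A ⟶ B),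
          (ModelFrobenioid.skelPresection (arithDivisorFunctor F K) (unitsFunctor F K) (divNatTrans F K)).hom f →
            P'.hom ((PreFrobenioid.Perfection.toPf (arithFrobenioid_isFrobenioid F K)).map f)) ∧
        PreFrobenioid.IsBaseFrobeniusPair
            (PreFrobenioid.Perfection.ops (arithFrobenioid_isFrobenioid F K)).toFunctor P' Fr' ∧
          ∀ (n : ℕ+) (A : arithFrobenioid F K)
            (hA : (ModelFrobenioid.skelPresection (arithDivisorFunctor F K) (unitsFunctor F K) (divNatTrans F K)).obj A),
            (PreFrobenioid.Perfection.toPf (arithFrobenioid_isFrobenioid F K)).map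
                ((ModelFrobenioid.skelFrobeniusSection (arithDivisorFunctor F K) (unitsFunctor F K)
                  (divNatTrans F K) n).app ⟨A, hA⟩) =
              (Fr' n).app ⟨(PreFrobenioid.Perfection.toPf (arithFrobenioid_isFrobenioid F K)).obj A, hobj A hA⟩ :=
  PreFrobenioid.Perfection.exists_isBaseFrobeniusPair_image (arithFrobenioid_isFrobenioid F K)
    (ModelFrobenioid.isBaseFrobeniusPair_skel (arithDivisorFunctor_isDivisorial F K) (unitsFunctor_isGroupLike F K))

omit [IsGalois F K] in
/-- **[FrdI] Thm. 5.2 (ii) at `C_{K/F}`, unit clauses** (print p. 101: the functor `O^×(−)` on `C^birat` and its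
compatibility with `O^×(−) → Φ^gp`): for `α ∈ O^×(X)`, `Div(α) = 0` and `Div_B(u_α) = 0`; and `O^×(X) → B(A_D)` is
injective — the sharpness / integrality binders supplied by the divisoriality of `Φ(Spec L)`.
[cite: MochizukiFrdI2008, Thm. 5.2(ii) p.101] -/
theorem modelFrobenioid_units_arith (X : arithFrobenioid F K) :
    (∀ {α : Aut X}, α ∈ ModelFrobenioid.units X → ModelFrobenioid.div α.hom = 1) ∧
      (∀ α : ModelFrobenioid.units X,
        divB (arithDivisorFunctor F K) (unitsFunctor F K) (divNatTrans F K) (op X.base)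
          (ModelFrobenioid.unitsToRatFn X α) = 1) ∧
      Function.Injective (ModelFrobenioid.unitsToRatFn X) :=
  ⟨fun hα => ModelFrobenioid.div_eq_one_of_mem_units (arithDivisorFunctor_isDivisorial F K X.base).isSharp hα,
    fun α => ModelFrobenioid.divB_unitsToRatFn_eq_one (arithDivisorFunctor_isDivisorial F K X.base).isSharp α,
    ModelFrobenioid.unitsToRatFn_injective (arithDivisorFunctor_isDivisorial F K X.base).isPreDivisorial.isIntegral⟩

/-- **[FrdI] Thm. 5.2 (iv) at `C_{K/F}`**: the typed statement `Thm52iv` holds for THE birationalization of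
`C_{K/F}`, no square-completion binder (`thm52iv_holds'`). [cite: MochizukiFrdI2008, Thm. 5.2(iv) p.101] -/
theorem thm52iv_arith :
    PreFrobenioid.Thm52iv (ModelFrobenioid.toElem (arithDivisorFunctor F K) (unitsFunctor F K) (divNatTrans F K))
      (arithFrobenioid_isFrobenioid F K)
      (PreFrobenioid.hasBiratSquares_of_isFrobenioid (arithFrobenioid_isFrobenioid F K)) :=
  PreFrobenioid.thm52iv_holds' (arithFrobenioid_isFrobenioid F K)

end Arith

section ArithPair

variable (F₁ : Type) [Field F₁] [NumberField F₁] (K₁ : Type) [Field K₁] [Algebra F₁ K₁] [IsGalois F₁ K₁]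
  (F₂ : Type) [Field F₂] [NumberField F₂] (K₂ : Type) [Field K₂] [Algebra F₂ K₂] [IsGalois F₂ K₂]

/-- **[FrdI] Thm. 4.2 (i)(ii) AS TYPED at a pair of arithmetic Frobenioids `C_{K₁/F₁}`, `C_{K₂/F₂}` and every
equivalence `Ψ`** — `FrdI.T42.thm42i_ofFunctor` / `thm42ii_ofFunctor` with "`Φ_i` perf-factorial" supplied by
`EffArithDivisor.isPerfFactorial` (Thm. 6.4 (i), proof p. 115). [cite: MochizukiFrdI2008, Thm. 4.2 (i) p.77] -/
theorem thm42i_ii_arith (Ψ : arithFrobenioid F₁ K₁ ≌ arithFrobenioid F₂ K₂) :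
    (PreFrobenioidData.ofFunctor (arithDivisorFunctor F₁ K₁)
        (ModelFrobenioid.toElem (arithDivisorFunctor F₁ K₁) (unitsFunctor F₁ K₁) (divNatTrans F₁ K₁))).Thm42i
      (PreFrobenioidData.ofFunctor (arithDivisorFunctor F₂ K₂)
        (ModelFrobenioid.toElem (arithDivisorFunctor F₂ K₂) (unitsFunctor F₂ K₂) (divNatTrans F₂ K₂))) Ψ ∧
    (PreFrobenioidData.ofFunctor (arithDivisorFunctor F₁ K₁)
        (ModelFrobenioid.toElem (arithDivisorFunctor F₁ K₁) (unitsFunctor F₁ K₁) (divNatTrans F₁ K₁))).Thm42ii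
      (PreFrobenioidData.ofFunctor (arithDivisorFunctor F₂ K₂)
        (ModelFrobenioid.toElem (arithDivisorFunctor F₂ K₂) (unitsFunctor F₂ K₂) (divNatTrans F₂ K₂))) Ψ :=
  ⟨FrdI.T42.thm42i_ofFunctor Ψ (arithFrobenioid_isFrobenioid F₁ K₁) (arithFrobenioid_isFrobenioid F₂ K₂)
      (fun X => EffArithDivisor.isPerfFactorial X.L) (fun X => EffArithDivisor.isPerfFactorial X.L),
    FrdI.T42.thm42ii_ofFunctor Ψ (arithFrobenioid_isFrobenioid F₁ K₁) (arithFrobenioid_isFrobenioid F₂ K₂)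
      (fun X => EffArithDivisor.isPerfFactorial X.L) (fun X => EffArithDivisor.isPerfFactorial X.L)⟩

/-- **[FrdI] Cor. 4.10 AS TYPED at THE birationalizations of `C_{K₁/F₁}`, `C_{K₂/F₂}` and every `Ψ`** — both the
square-completion binders (Prop. 4.4) and the FSM-type binders (`FinSubextCat.isOfFSMType`, Thm. 6.2 (iii)) of
`cor410_biratData_of_isOfFSMType` supplied. [cite: MochizukiFrdI2008, Cor. 4.10 p.90] -/
theorem cor410_biratData_arith (Ψ : arithFrobenioid F₁ K₁ ≌ arithFrobenioid F₂ K₂) :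
    PreFrobenioidData.Cor410
      (PreFrobenioidData.ofFunctor (arithDivisorFunctor F₁ K₁)
        (ModelFrobenioid.toElem (arithDivisorFunctor F₁ K₁) (unitsFunctor F₁ K₁) (divNatTrans F₁ K₁)))
      (PreFrobenioidData.ofFunctor (arithDivisorFunctor F₂ K₂)
        (ModelFrobenioid.toElem (arithDivisorFunctor F₂ K₂) (unitsFunctor F₂ K₂) (divNatTrans F₂ K₂))) Ψ
      (PreFrobenioid.biratData (arithFrobenioid_isFrobenioid F₁ K₁)
        (PreFrobenioid.hasBiratSquares_of_isFrobenioid (arithFrobenioid_isFrobenioid F₁ K₁)))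
      (PreFrobenioid.biratData (arithFrobenioid_isFrobenioid F₂ K₂)
        (PreFrobenioid.hasBiratSquares_of_isFrobenioid (arithFrobenioid_isFrobenioid F₂ K₂))) :=
  PreFrobenioid.cor410_biratData_of_isOfFSMType _ _ _ _ (FinSubextCat.isOfFSMType F₁ K₁)
    (FinSubextCat.isOfFSMType F₂ K₂) Ψ

end ArithPair

/-! ## C. At the monoid `Φ(Spec L)` of effective arithmetic divisors ([FrdI] Ex. 6.3) -/

section Divisors

variable (L : Type) [Field L] [NumberField L]

/-- **[FrdI] Prop. 4.1 (ii), necessity, at `Φ(Spec L)`** (perf-factorial, `EffArithDivisor.isPerfFactorial`) with the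
primary elements `x = δ_𝔭^a`, `x · y = δ_𝔭^(a+b)` (`a ≥ 1`; `δ_𝔭` primary, `EffArithDivisor.isPrimary_single`): if
`δ_𝔭^a · δ_𝔭^b = x' · y'` with `x' ≠ 0` then some `0 ≠ x'' ≤ δ_𝔭^a, x'`. [cite: MochizukiFrdI2008, Prop. 4.1 (ii) p.76] -/
theorem exists_common_dvd_single_pow (𝔭 : Places L) {a b : ℕ} (ha : 0 < a)
    {x' y' : Multiplicative (EffArithDivisor L)} (hx' : x' ≠ 1)
    (he : Multiplicative.ofAdd (EffArithDivisor.single L 𝔭) ^ a * Multiplicative.ofAdd (EffArithDivisor.single L 𝔭) ^ b =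
      x' * y') :
    ∃ x'' : Multiplicative (EffArithDivisor L), x'' ≠ 1 ∧
      x'' ∣ Multiplicative.ofAdd (EffArithDivisor.single L 𝔭) ^ a ∧ x'' ∣ x' :=
  (EffArithDivisor.isPerfFactorial L).exists_common_dvd_of_isPrimary_mul
    ((EffArithDivisor.isPrimary_single 𝔭).pow (EffArithDivisor.isDivisorial L).isSharp ha)
    (by
      rw [← pow_add]
      exact (EffArithDivisor.isPrimary_single 𝔭).pow (EffArithDivisor.isDivisorial L).isSharp (Nat.add_pos_left ha b))
    hx' he

end Divisors

/-! ## D. At THE `p`-adic Frobenioid `C₀(p)` over `D₀` ([FrdII] Ex. 1.1 (i)) -/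

namespace PadicFrd

variable (p : ℕ) [Fact p.Prime]

/-- **[FrdI] Prop. 1.13 (iii) at THE `C₀(p)` over the slim base `D₀`** (its printed consumer is [FrdII] Thm. 1.2 (iv)):
every component of an automorphism of `C_A → C` is trivial — `PreFrobenioid.autApp_eq_one_of_slimHypothesisB`
with `SlimHypothesisB` supplied by `Datum.slimHypothesisB_of_isOfFSMType` (`D₀` of FSM-type, [FrdII] p. 7) and
"`D` slim" by `dZero_isSlim`. [cite: MochizukiFrdI2008, Prop. 1.13(iii) p.40] -/
theorem czeroGal_autApp_eq_one {A : CZeroGal p} (α : Over.forget A ≅ Over.forget A) (U : Over A) :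
    PreFrobenioid.autApp α U = 1 :=
  PreFrobenioid.autApp_eq_one_of_slimHypothesisB (czeroGal_isFrobenioid p) (dZero_isSlim p) α U
    ((Datum.zeroGal p).slimHypothesisB_of_isOfFSMType (dZero_isOfFSMType p) U.left)

end PadicFrd

/-! ## E. At print's own group-like Example 3.6 ([FrdI] p. 70) -/

/-- **[FrdI] Thm. 4.9, group-like branch** («[since Theorem 4.9 is vacuous if `C₁`, `C₂` are of group-like type]»,
p. 89) **at Example 3.6** `C = F_Φ → F_{Φ^char}` (of group-like type, `Ex36.isOfGroupLikeType`), for every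
self-equivalence `Ψ` of `F_Φ`: an isomorphism `Ψ^Φ` lying over `Ψ` exists.
[cite: MochizukiFrdI2008, Thm. 4.9 p.89] -/
theorem Ex36.nonempty_divisorMonoidIsoOver (Ψ : ElemFrobenioid Ex36.Φ ≌ ElemFrobenioid Ex36.Φ) :
    Nonempty (PreFrobenioidData.DivisorMonoidIsoOver
      (PreFrobenioidData.ofFunctor (charFunctor Ex36.Φ) (ElemFrobenioid.toChar Ex36.Φ))
      (PreFrobenioidData.ofFunctor (charFunctor Ex36.Φ) (ElemFrobenioid.toChar Ex36.Φ)) Ψ) :=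
  FrdI.T49.nonempty_divisorMonoidIsoOver_of_isOfGroupLikeType _ _ Ψ Ex36.isOfGroupLikeType Ex36.isOfGroupLikeType

end Literature.AlgebraicGeometry.Frobenioids
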